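import Summits.CriticalPhenomena.PercolationContinuityZ3.Theorems.PercNearOneGluingAdditiveGluingFingerBridgeGraph
import HarnessLib

/-! # Crux `PercNearOneGluing.AdditiveGluing` (stmt-CriticalPhenomena-4576) — pattern reliabilities of a finger block with two contact relays
# (seat (b) V⁺-form, depth prover `png-dp-vplus`)

Support file (`--supports stmt-CriticalPhenomena-4576`); no definitions, no named facts.  Companion of `…AdditiveGluingFingerBridgeGraph.lean`.

A finger block `N` whose fingers (vertices of `N`, pairwise non-adjacent in `K`) have positive-weight pairs only to the two relays `w₁, w₂`;
`F` = the contact pairs `s(v, w_i)`; `q` = `K` with every pair at `N` killed.  For a pattern `J ⊆ F` (pairs of `J` open, of `F ∖ J` closed):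
* `pinW K F J` (fingers separate): the reliability of a vertex `y ∉ N` equals the base quantity
  `A_Q(y) := μ_q{ω | y ↔ b in (ω ∖ pairs at N) ∪ Q}` with `Q = {s(w₁,w₂)}` if some finger has BOTH its pairs in `J` ("bridged") and `Q = ∅`
  otherwise (`real_openConn_pinW_unglued`);
* `pinW (K/N) F J` (block glued): the same with `Q = {s(w₁,w₂)}` iff BOTH relays are touched by `J`, and the block's reach `⋃_v {v ↔ b}` has the
  reliability of any touched relay (`real_openConn_pinW_glued`, `real_blockReach_pinW_glued`).
Tools: the detour lemma and the almost-sure structure of the pairs at the block (`real_openConn_eq_of_blockPairs_nd`, a variant of the landed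
`real_openConn_eq_of_blockPairs` that ignores loops).  These feed the two-contact case of `stub_fingerML3_vp` (`…AdditiveGluingFingerTwoContacts.lean`).
[folklore; Grimmett 1999 §1.3–2.2; KozmaNitzan2024 §3.1, §4 p. 20]
-/

namespace Summit.CriticalPhenomena.PercolationContinuityZ3.Theorems

open MeasureTheory Set
open Literature.Probability.LatticeModels (prodBernoulli)
open Literature.Probability.Percolation (BondConfig openConn openGraph pinW localCylinder DeterminedBy determinedBy_iff)

noncomputable section
open Classical

section FingerBridgeValues

open Literature.Probability.LatticeModels Literature.Probability.Percolation

variable {n : ℕ}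

/-! ### Almost-sure structure ignoring loops -/

/-- If `p = 1` on the pairs of `O` and `p = 0` on every NON-LOOP pair meeting `N` outside `O`, then almost surely the open graph of `ω` is the open
graph of `(ω ∖ pairs at N) ∪ O`. [folklore] -/
theorem ae_openGraph_eq_blockPairs (p : Sym2 (Fin n) → unitInterval) (N : Finset (Fin n)) (O : Finset (Sym2 (Fin n)))
    (h1 : ∀ e ∈ O, p e = 1) (h0 : ∀ e : Sym2 (Fin n), e ∉ O → ¬ e.IsDiag → (∃ z ∈ e, z ∈ N) → p e = 0) :
    ∀ᵐ ω ∂(prodBernoulli p), openGraph ω = openGraph (({e | e ∈ ω ∧ ∀ z ∈ e, z ∉ N} ∪ ↑O : Set (Sym2 (Fin n))) : BondConfig (Fin n)) := by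
  have hO : ∀ᵐ ω ∂(prodBernoulli p), ∀ e ∈ O, e ∈ ω :=
    Filter.eventually_all_finset O |>.2 fun e he => prodBernoulli_ae_mem_of_eq_one p (h1 e he)
  have hZ : ∀ᵐ ω ∂(prodBernoulli p),
      ∀ e ∈ (Finset.univ.filter fun e : Sym2 (Fin n) => e ∉ O ∧ ¬ e.IsDiag ∧ ∃ z ∈ e, z ∈ N), e ∉ ω := by
    refine (Filter.eventually_all_finset _).2 fun e he => ?_
    obtain ⟨heO, hnd, hz⟩ := (Finset.mem_filter.1 he).2
    exact prodBernoulli_ae_notMem p (h0 e heO hnd hz)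
  filter_upwards [hO, hZ] with ω hωO hωZ
  ext u v
  simp only [openGraph_adj, Set.mem_union, Set.mem_setOf_eq, Finset.mem_coe]
  constructor
  · rintro ⟨huv, hne⟩
    refine ⟨?_, hne⟩
    by_cases heO : s(u, v) ∈ O
    · exact Or.inr heO
    · left
      refine ⟨huv, fun z hz hzN => ?_⟩
      exact hωZ _ (Finset.mem_filter.2 ⟨Finset.mem_univ _, heO, fun h => hne (Sym2.mk_isDiag_iff.1 h), z, hz, hzN⟩) huv
  · rintro ⟨h | heO, hne⟩
    · exact ⟨h.1, hne⟩
    · exact ⟨hωO _ heO, hne⟩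

/-- **Reliability as a base quantity (loops ignored).**  As `real_openConn_eq_of_blockPairs`, but `p = 0` is only required on NON-LOOP pairs meeting
`N` outside `O`. [folklore; KozmaNitzan2024 §4 p. 20] -/
theorem real_openConn_eq_of_blockPairs_nd (p q : Sym2 (Fin n) → unitInterval) (N : Finset (Fin n)) (O : Finset (Sym2 (Fin n)))
    (Q : Set (Sym2 (Fin n)))
    (h1 : ∀ e ∈ O, p e = 1) (h0 : ∀ e : Sym2 (Fin n), e ∉ O → ¬ e.IsDiag → (∃ z ∈ e, z ∈ N) → p e = 0)
    (hQ : ∀ e ∈ Q, ∀ z ∈ e, z ∉ N)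
    (ha : ∀ e ∈ Q, ∀ u ∈ e, ∀ u' ∈ e, (openGraph (↑O : Set (Sym2 (Fin n)))).Reachable u u')
    (hb : ∀ u u' : Fin n, u ∉ N → u' ∉ N → (openGraph (↑O : Set (Sym2 (Fin n)))).Reachable u u' → (openGraph Q).Reachable u u')
    (hpq : ∀ e : Sym2 (Fin n), (∀ z ∈ e, z ∉ N) → p e = q e) {y b : Fin n} (hy : y ∉ N) (hbN : b ∉ N) :
    (prodBernoulli p).real (openConn y b) =
      (prodBernoulli q).real {ω : BondConfig (Fin n) |
        (openGraph (({e | e ∈ ω ∧ ∀ z ∈ e, z ∉ N} ∪ Q : Set (Sym2 (Fin n))) : BondConfig (Fin n))).Reachable y b} := by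
  set E : Set (BondConfig (Fin n)) := {ω : BondConfig (Fin n) |
    (openGraph (({e | e ∈ ω ∧ ∀ z ∈ e, z ∉ N} ∪ Q : Set (Sym2 (Fin n))) : BondConfig (Fin n))).Reachable y b} with hE
  have hae : ∀ᵐ ω ∂(prodBernoulli p), ω ∈ (openConn y b : Set (BondConfig (Fin n))) ↔ ω ∈ E := by
    filter_upwards [ae_openGraph_eq_blockPairs p N O h1 h0] with ω hω
    have hω' : ∀ e ∈ ({e | e ∈ ω ∧ ∀ z ∈ e, z ∉ N} : Set (Sym2 (Fin n))), ∀ z ∈ e, z ∉ N := fun e he => he.2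
    have key := reach_detour_iff N (ω' := {e | e ∈ ω ∧ ∀ z ∈ e, z ∉ N}) (O := (↑O : Set (Sym2 (Fin n)))) (Q := Q)
      hω' hQ ha hb hy hbN
    show (openGraph ω).Reachable y b ↔ _
    rw [hω]
    exact key
  have heq : (openConn y b : Set (BondConfig (Fin n))) =ᵐ[prodBernoulli p] E := hae.mono fun ω h => propext h
  rw [measureReal_congr heq]
  exact prodBernoulli_real_eq_of_determinedBy p q (fun e he => hpq e he) (determinedBy_reach_offBlock_union N Q y b)
    MeasurableSet.of_discrete

/-! ### The detour conditions for two contact relays -/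

/-- Condition (b), UNGLUED and UNBRIDGED: if every finger has at most one pair in `J` (pairs `s(v, w)`, `v ∈ N`, `w ∉ N`), then two outside
vertices joined by `J` alone are equal. [folklore] -/
theorem detour_b_unbridged (N : Finset (Fin n)) (J : Finset (Sym2 (Fin n)))
    (hJ : ∀ e ∈ J, ∃ v ∈ N, ∃ w ∉ N, e = s(v, w))
    (hunbr : ∀ v ∈ N, ∀ w w' : Fin n, s(v, w) ∈ J → s(v, w') ∈ J → w ∉ N → w' ∉ N → w = w')
    (u u' : Fin n) (hu : u ∉ N) (hu' : u' ∉ N) (h : (openGraph (↑J : Set (Sym2 (Fin n)))).Reachable u u') :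
    (openGraph (∅ : Set (Sym2 (Fin n)))).Reachable u u' := by
  -- closed set: `u` together with the fingers attached to `u`
  obtain ⟨p⟩ := h
  let S : Set (Fin n) := fun z => z = u ∨ (z ∈ N ∧ s(z, u) ∈ J)
  suffices key : ∀ (x z : Fin n) (r : (openGraph (↑J : Set (Sym2 (Fin n)))).Walk x z), S x → S z by
    rcases key u u' p (Or.inl rfl) with h | ⟨hu'N, -⟩
    · rw [h]
    · exact (hu' hu'N).elim
  intro x z r
  induction r with
  | nil => exact id
  | cons hadj r ih =>
    intro hx
    refine ih ?_
    rename_i x' z' _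
    obtain ⟨hmem, hne⟩ := (openGraph_adj _ x' z').1 hadj
    have hmemJ : s(x', z') ∈ J := Finset.mem_coe.1 hmem
    obtain ⟨v, hv, w, hw, he⟩ := hJ _ hmemJ
    rcases hx with rfl | ⟨hxN, hxu⟩
    · -- `x' = u ∉ N`, so `x' = w` and `z' = v ∈ N` with `s(z', u) ∈ J`
      rcases Sym2.eq_iff.1 he with ⟨h1, h2⟩ | ⟨h1, h2⟩
      · exact (hu (h1 ▸ hv)).elim
      · right
        refine ⟨h2 ▸ hv, ?_⟩
        rw [Sym2.eq_swap]; exact hmemJ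
    · -- `x' ∈ N` attached to `u`: its only `J`-pair is `s(x', u)`
      rcases Sym2.eq_iff.1 he with ⟨h1, h2⟩ | ⟨h1, h2⟩
      · -- `x' = v`, `z' = w ∉ N`
        subst h1; subst h2
        left
        exact hunbr x' hxN z' u (hmemJ) hxu hw hu
      · -- `x' = w ∉ N`: contradiction
        exact (hw (h1 ▸ hxN)).elim

/-- Condition (b), general form: if every pair of `O` is a contact pair of `J` (pairs `s(v,w)`, `v ∈ N`, `w ∈ W`) or a
pair inside `N`, then two outside vertices joined by `O` alone are equal or both lie in the touched set `{w ∈ W | ∃ v ∈ N, s(v,w) ∈ J}`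
(`W` any set of relays). [folklore] -/
theorem detour_b_touched (N W : Finset (Fin n)) (J : Finset (Sym2 (Fin n))) (O : Set (Sym2 (Fin n)))
    (hO : ∀ e ∈ O, (e ∈ J ∧ ∃ v ∈ N, ∃ w ∈ W, e = s(v, w)) ∨ (∀ z ∈ e, z ∈ N))
    (u u' : Fin n) (hu : u ∉ N) (hu' : u' ∉ N) (h : (openGraph O).Reachable u u') :
    u = u' ∨ ((u ∈ W ∧ ∃ v ∈ N, s(v, u) ∈ J) ∧ (u' ∈ W ∧ ∃ v ∈ N, s(v, u') ∈ J)) := by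
  -- closed set: `{x}`, the block, and the touched relays
  have key : ∀ (x : Fin n), x ∉ N → ∀ (a z : Fin n) (r : (openGraph O).Walk a z),
      (a = x ∨ a ∈ N ∨ (a ∈ W ∧ ∃ v ∈ N, s(v, a) ∈ J)) → (z = x ∨ z ∈ N ∨ (z ∈ W ∧ ∃ v ∈ N, s(v, z) ∈ J)) := by
    intro x hx a z r
    induction r with
    | nil => exact id
    | cons hadj r ih =>
      intro ha
      refine ih ?_
      rename_i a' z' _
      obtain ⟨hmem, hne⟩ := (openGraph_adj _ a' z').1 hadj
      rcases hO _ hmem with ⟨heJ, v, hv, w, hw, he⟩ | hin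
      · rcases Sym2.eq_iff.1 he with ⟨h1, h2⟩ | ⟨h1, h2⟩
        · subst h1; subst h2
          exact Or.inr (Or.inr ⟨hw, a', hv, heJ⟩)
        · subst h1; subst h2
          exact Or.inr (Or.inl hv)
      · exact Or.inr (Or.inl (hin z' (Sym2.mem_mk_right a' z')))
  -- from `u` to `u'` and back
  obtain ⟨p⟩ := h
  have h1 := key u hu u u' p (Or.inl rfl)
  have h2 := key u' hu' u' u p.reverse (Or.inl rfl)
  rcases h1 with h | h | h
  · exact Or.inl h.symm
  · exact (hu' h).elim
  · rcases h2 with h' | h' | h'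
    · exact Or.inl h'
    · exact (hu h').elim
    · exact Or.inr ⟨h', h⟩


/-! ### Pattern reliabilities for a finger block with contact relays `w₁, w₂` -/

section TwoRelays

variable (K : Sym2 (Fin n) → unitInterval) (N : Finset (Fin n)) (w₁ w₂ b : Fin n)

/-- Weights of the non-contact pairs at a two-relay finger block vanish (off loops): internal pairs by `hint`, the others by `hcont`. -/
theorem twoRelay_weight_zero (hw₁ : w₁ ∉ N) (hw₂ : w₂ ∉ N)
    (hint : ∀ v ∈ N, ∀ v' ∈ N, v ≠ v' → K s(v, v') = 0)
    (hcont : ∀ v ∈ N, ∀ z : Fin n, z ∉ N → z ≠ w₁ → z ≠ w₂ → K s(v, z) = 0)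
    (e : Sym2 (Fin n)) (heF : e ∉ N.image (fun v => s(v, w₁)) ∪ N.image (fun v => s(v, w₂))) (hnd : ¬ e.IsDiag)
    (hz : ∃ z ∈ e, z ∈ N) : K e = 0 := by
  have _ := hw₁; have _ := hw₂
  induction e using Sym2.ind with
  | h x y =>
    have hne : x ≠ y := fun h => hnd (Sym2.mk_isDiag_iff.2 h)
    have key : ∀ a c : Fin n, a ∈ N → a ≠ c → s(a, c) ∉ N.image (fun v => s(v, w₁)) ∪ N.image (fun v => s(v, w₂)) → K s(a, c) = 0 := by
      intro a c ha hac hF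
      by_cases hc : c ∈ N
      · exact hint a ha c hc hac
      · have hc1 : c ≠ w₁ := by
          rintro rfl
          exact hF (Finset.mem_union.2 (Or.inl (Finset.mem_image.2 ⟨a, ha, rfl⟩)))
        have hc2 : c ≠ w₂ := by
          rintro rfl
          exact hF (Finset.mem_union.2 (Or.inr (Finset.mem_image.2 ⟨a, ha, rfl⟩)))
        exact hcont a ha c hc hc1 hc2
    obtain ⟨z, hz, hzN⟩ := hz
    rcases Sym2.mem_iff.1 hz with rfl | rfl
    · exact key z y hzN hne heF
    · rw [Sym2.eq_swap]
      rw [Sym2.eq_swap] at heF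
      exact key z x hzN (Ne.symm hne) heF

/-- **Un-glued pattern reliability, bridged pattern.**  `J ⊆ F` with some finger having both its pairs in `J`: for `y, b ∉ N`,
`μ_{pinW K F J}(y ↔ b) = μ_q{y ↔ b in (ω ∖ pairs at N) ∪ {s(w₁,w₂)}}`. [folklore; KozmaNitzan2024 §4 p. 20] -/
theorem real_openConn_pinW_unglued_bridged (hw₁ : w₁ ∉ N) (hw₂ : w₂ ∉ N) (h12 : w₁ ≠ w₂)
    (hint : ∀ v ∈ N, ∀ v' ∈ N, v ≠ v' → K s(v, v') = 0)
    (hcont : ∀ v ∈ N, ∀ z : Fin n, z ∉ N → z ≠ w₁ → z ≠ w₂ → K s(v, z) = 0)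
    (J : Finset (Sym2 (Fin n))) (hJF : J ⊆ N.image (fun v => s(v, w₁)) ∪ N.image (fun v => s(v, w₂)))
    (hbr : ∃ v ∈ N, s(v, w₁) ∈ J ∧ s(v, w₂) ∈ J) {y : Fin n} (hy : y ∉ N) (hbN : b ∉ N) :
    (prodBernoulli (pinW K (↑(N.image (fun v => s(v, w₁)) ∪ N.image (fun v => s(v, w₂))) : Set (Sym2 (Fin n))) ↑J)).real
        (openConn y b) =
      (prodBernoulli (fun e : Sym2 (Fin n) => if (∃ z ∈ e, z ∈ N) then (0 : unitInterval) else K e)).real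
        {ω : BondConfig (Fin n) | (openGraph (({e | e ∈ ω ∧ ∀ z ∈ e, z ∉ N} ∪ {s(w₁, w₂)} : Set (Sym2 (Fin n))) :
          BondConfig (Fin n))).Reachable y b} := by
  set F : Finset (Sym2 (Fin n)) := N.image (fun v => s(v, w₁)) ∪ N.image (fun v => s(v, w₂)) with hFdef
  have hJ : ∀ e ∈ J, ∃ v ∈ N, ∃ w ∈ ({w₁, w₂} : Finset (Fin n)), e = s(v, w) := by
    intro e he
    rcases Finset.mem_union.1 (hJF he) with h | h
    · obtain ⟨v, hv, rfl⟩ := Finset.mem_image.1 h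
      exact ⟨v, hv, w₁, by simp, rfl⟩
    · obtain ⟨v, hv, rfl⟩ := Finset.mem_image.1 h
      exact ⟨v, hv, w₂, by simp, rfl⟩
  refine real_openConn_eq_of_blockPairs_nd _ _ N J {s(w₁, w₂)} ?_ ?_ ?_ ?_ ?_ ?_ hy hbN
  · intro e he
    exact pinW_apply_of_mem_of_mem K (Finset.mem_coe.2 (hJF he)) (Finset.mem_coe.2 he)
  · intro e heJ hnd hz
    by_cases heF : e ∈ F
    · exact pinW_apply_of_mem_of_not_mem K (Finset.mem_coe.2 heF) (fun h => heJ (Finset.mem_coe.1 h))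
    · rw [pinW_apply_of_not_mem K _ (fun h => heF (Finset.mem_coe.1 h))]
      exact twoRelay_weight_zero K N w₁ w₂ hw₁ hw₂ hint hcont e heF hnd hz
  · intro e he z hz
    rw [Set.mem_singleton_iff.1 he] at hz
    rcases Sym2.mem_iff.1 hz with rfl | rfl
    · exact hw₁
    · exact hw₂
  · intro e he u hu u' hu'
    rw [Set.mem_singleton_iff.1 he] at hu hu'
    obtain ⟨v, hv, hv1, hv2⟩ := hbr
    have hreach : ∀ x ∈ s(w₁, w₂), (openGraph (↑J : Set (Sym2 (Fin n)))).Reachable v x := by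
      intro x hx
      rcases Sym2.mem_iff.1 hx with rfl | rfl
      · exact ((openGraph_adj _ v x).2 ⟨Finset.mem_coe.2 hv1, fun h => hw₁ (h ▸ hv)⟩).reachable
      · exact ((openGraph_adj _ v x).2 ⟨Finset.mem_coe.2 hv2, fun h => hw₂ (h ▸ hv)⟩).reachable
    exact (hreach u hu).symm.trans (hreach u' hu')
  · intro u u' hu hu' h
    have hO : ∀ e ∈ (↑J : Set (Sym2 (Fin n))),
        (e ∈ J ∧ ∃ v ∈ N, ∃ w ∈ ({w₁, w₂} : Finset (Fin n)), e = s(v, w)) ∨ (∀ z ∈ e, z ∈ N) :=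
      fun e he => Or.inl ⟨Finset.mem_coe.1 he, hJ e (Finset.mem_coe.1 he)⟩
    rcases detour_b_touched N {w₁, w₂} J (↑J) hO u u' hu hu' h with rfl | ⟨⟨huW, -⟩, ⟨hu'W, -⟩⟩
    · exact SimpleGraph.Reachable.refl _
    · by_cases huu : u = u'
      · rw [huu]
      · have hpair : s(u, u') = s(w₁, w₂) := by
          simp only [Finset.mem_insert, Finset.mem_singleton] at huW hu'W
          rcases huW with rfl | rfl <;> rcases hu'W with rfl | rfl
          · exact (huu rfl).elim
          · rfl
          · exact Sym2.eq_swap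
          · exact (huu rfl).elim
        exact ((openGraph_adj _ u u').2 ⟨by rw [hpair]; exact Set.mem_singleton _, huu⟩).reachable
  · intro e he
    have heF : e ∉ (↑F : Set (Sym2 (Fin n))) := by
      intro heF
      rcases Finset.mem_union.1 (Finset.mem_coe.1 heF) with h | h
      · obtain ⟨v, hv, rfl⟩ := Finset.mem_image.1 h
        exact he v (Sym2.mem_mk_left v w₁) hv
      · obtain ⟨v, hv, rfl⟩ := Finset.mem_image.1 h
        exact he v (Sym2.mem_mk_left v w₂) hv
    rw [pinW_apply_of_not_mem K _ heF]
    have : ¬ (∃ z ∈ e, z ∈ N) := fun ⟨z, hz, hzN⟩ => he z hz hzN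
    simp only [this, if_false]

/-- **Un-glued pattern reliability, unbridged pattern.**  `J ⊆ F` with NO finger having both its pairs in `J`: for `y, b ∉ N`,
`μ_{pinW K F J}(y ↔ b) = μ_q{y ↔ b in ω ∖ pairs at N}`. [folklore; KozmaNitzan2024 §4 p. 20] -/
theorem real_openConn_pinW_unglued_unbridged (hw₁ : w₁ ∉ N) (hw₂ : w₂ ∉ N)
    (hint : ∀ v ∈ N, ∀ v' ∈ N, v ≠ v' → K s(v, v') = 0)
    (hcont : ∀ v ∈ N, ∀ z : Fin n, z ∉ N → z ≠ w₁ → z ≠ w₂ → K s(v, z) = 0)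
    (J : Finset (Sym2 (Fin n))) (hJF : J ⊆ N.image (fun v => s(v, w₁)) ∪ N.image (fun v => s(v, w₂)))
    (hnbr : ¬ ∃ v ∈ N, s(v, w₁) ∈ J ∧ s(v, w₂) ∈ J) {y : Fin n} (hy : y ∉ N) (hbN : b ∉ N) :
    (prodBernoulli (pinW K (↑(N.image (fun v => s(v, w₁)) ∪ N.image (fun v => s(v, w₂))) : Set (Sym2 (Fin n))) ↑J)).real
        (openConn y b) =
      (prodBernoulli (fun e : Sym2 (Fin n) => if (∃ z ∈ e, z ∈ N) then (0 : unitInterval) else K e)).real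
        {ω : BondConfig (Fin n) | (openGraph (({e | e ∈ ω ∧ ∀ z ∈ e, z ∉ N} ∪ (∅ : Set (Sym2 (Fin n))) : Set (Sym2 (Fin n))) :
          BondConfig (Fin n))).Reachable y b} := by
  set F : Finset (Sym2 (Fin n)) := N.image (fun v => s(v, w₁)) ∪ N.image (fun v => s(v, w₂)) with hFdef
  have hJ : ∀ e ∈ J, ∃ v ∈ N, ∃ w ∉ N, e = s(v, w) := by
    intro e he
    rcases Finset.mem_union.1 (hJF he) with h | h
    · obtain ⟨v, hv, rfl⟩ := Finset.mem_image.1 h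
      exact ⟨v, hv, w₁, hw₁, rfl⟩
    · obtain ⟨v, hv, rfl⟩ := Finset.mem_image.1 h
      exact ⟨v, hv, w₂, hw₂, rfl⟩
  refine real_openConn_eq_of_blockPairs_nd _ _ N J ∅ ?_ ?_ ?_ ?_ ?_ ?_ hy hbN
  · intro e he
    exact pinW_apply_of_mem_of_mem K (Finset.mem_coe.2 (hJF he)) (Finset.mem_coe.2 he)
  · intro e heJ hnd hz
    by_cases heF : e ∈ F
    · exact pinW_apply_of_mem_of_not_mem K (Finset.mem_coe.2 heF) (fun h => heJ (Finset.mem_coe.1 h))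
    · rw [pinW_apply_of_not_mem K _ (fun h => heF (Finset.mem_coe.1 h))]
      exact twoRelay_weight_zero K N w₁ w₂ hw₁ hw₂ hint hcont e heF hnd hz
  · intro e he; exact (Set.notMem_empty e he).elim
  · intro e he; exact (Set.notMem_empty e he).elim
  · intro u u' hu hu' h
    refine detour_b_unbridged N J hJ ?_ u u' hu hu' h
    intro v hv w w' hw hw' hwN hw'N
    -- both pairs are contact pairs of `v`; if `w ≠ w'` then `{w, w'} = {w₁, w₂}` and `J` would be bridged
    have hmemW : ∀ x : Fin n, x ∉ N → s(v, x) ∈ J → x = w₁ ∨ x = w₂ := by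
      intro x hxN hx
      rcases Finset.mem_union.1 (hJF hx) with h | h
      · obtain ⟨v', hv', he⟩ := Finset.mem_image.1 h
        rcases Sym2.eq_iff.1 he with ⟨h1, h2⟩ | ⟨h1, h2⟩
        · exact Or.inl h2.symm
        · exact (hxN (h1 ▸ hv')).elim
      · obtain ⟨v', hv', he⟩ := Finset.mem_image.1 h
        rcases Sym2.eq_iff.1 he with ⟨h1, h2⟩ | ⟨h1, h2⟩
        · exact Or.inr h2.symm
        · exact (hxN (h1 ▸ hv')).elim
    by_contra hne
    rcases hmemW w hwN hw with rfl | rfl <;> rcases hmemW w' hw'N hw' with h' | h'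
    · exact hne h'.symm
    · subst h'; exact hnbr ⟨v, hv, hw, hw'⟩
    · subst h'; exact hnbr ⟨v, hv, hw', hw⟩
    · exact hne h'.symm
  · intro e he
    have heF : e ∉ (↑F : Set (Sym2 (Fin n))) := by
      intro heF
      rcases Finset.mem_union.1 (Finset.mem_coe.1 heF) with h | h
      · obtain ⟨v, hv, rfl⟩ := Finset.mem_image.1 h
        exact he v (Sym2.mem_mk_left v w₁) hv
      · obtain ⟨v, hv, rfl⟩ := Finset.mem_image.1 h
        exact he v (Sym2.mem_mk_left v w₂) hv
    rw [pinW_apply_of_not_mem K _ heF]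
    have : ¬ (∃ z ∈ e, z ∈ N) := fun ⟨z, hz, hzN⟩ => he z hz hzN
    simp only [this, if_false]

end TwoRelays




end FingerBridgeValues

end

end Summit.CriticalPhenomena.PercolationContinuityZ3.Theorems
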